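import Mathlib
import Summits.Ventures.PercRepro2.Defs
import Summits.Ventures.PercRepro2.Independence
import Summits.Ventures.PercRepro2.Harris
import Summits.Ventures.PercRepro2.Graph
import Summits.Ventures.PercRepro2.Exploration
import Summits.Ventures.PercRepro2.FourFunctions
import Summits.Ventures.PercRepro2.Induced
import Summits.Ventures.PercRepro2.Frontier
import Summits.Ventures.PercRepro2.ObsIndependence

/-!
# The van den Berg–Häggström–Kahn inequality for cluster functionals (blind cell PercRepro2, p1)

Van den Berg–Häggström–Kahn, *Some conditional correlation inequalities for percolation and
related processes*, Random Structures & Algorithms 29 (2006), doi:10.1002/rsa.20102, Theorem 1.1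
(functional form, Theorem 1.3): for a source `s`, nonnegative increasing functionals `F₁, F₂` of the
cluster `C_s` (increasing for `⊆`), and vertex sets `X, Y`, with `R_X = {s ↮ x ∀ x ∈ X}`,

  `E[F₁(C_s) 1_{R_X}] · E[F₂(C_s) 1_{R_Y}] ≤ E[(F₁F₂)(C_s) 1_{R_{X∩Y}}] · P(R_{X∪Y})`.

The case `F_i = 1{A_i ⊆ ·}` is van den Berg–Kahn's Theorem 1.2 (`VdBKahn.lean`); the case
`X = Y` says that the cluster of `s` is positively associated conditionally on `s ↮ X`.

The proof is the exploration argument of `VdBKahn.lean` with functionals in place of events: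
induction on the vertex set `U` (`G[U]`, `Induced.lean`), Harris' inequality for monotone
observables when `X ∩ Y = ∅`, otherwise explore the edges around `Z = X ∩ Y`: on `R_Z` the cluster
of `s` in `G[U]` is its cluster in `G[U ∖ Z]` and `s ↮ Z` becomes `s ↮ frontier` (`Frontier.lean`),
the tower identity `expect_tower` turns every term into `∑_ω weight p ω · (term on G[U ∖ Z])`, and
the four functions theorem on `Config E` closes the step.

The product rule and the tower identity for observables are in `ObsIndependence.lean`.
-/

namespace Summit.Ventures.PercRepro2

/-! ## Cluster functionals -/

section ClusterObs

variable {V : Type*} {E : Type*} {R : Type*} {ends : E → Sym2 V} {U : Finset V} {s : V}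

/-- The cluster is monotone in the configuration. -/
lemma clusterIn_mono {ω ω' : Config E} (h : ω ≤ ω') :
    clusterIn ends U s ω ⊆ clusterIn ends U s ω' :=
  cluster_mono (induced_mono h) s

/-- A monotone cluster functional is a monotone observable. -/
lemma monotone_clusterObs [Preorder R] {F : Set V → R} (hF : Monotone F) :
    Monotone (clusterObs ends U s F) :=
  fun _ _ h => hF (clusterIn_mono h)

/-- A functional that is monotone on the clusters of `s` (for all configurations) is a monotone
observable on every induced subgraph. -/
lemma monotone_clusterObs' [Preorder R] {F : Set V → R}
    (hF : ∀ ω ω' : Config E, cluster ends ω s ⊆ cluster ends ω' s →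
      F (cluster ends ω s) ≤ F (cluster ends ω' s)) :
    Monotone (clusterObs ends U s F) :=
  fun _ _ h => hF _ _ (clusterIn_mono h)

/-- `clusterObs` is determined by the edges inside `U`. -/
lemma dependsOn_clusterObs (F : Set V → R) :
    DependsOn (clusterObs ends U s F) (within ends (↑U)) := by
  intro ω ω' h
  simp only [clusterObs_apply, clusterIn, induced_congr h]

/-- `clusterObs` of a product is the product. -/
lemma clusterObs_mul [Mul R] (F₁ F₂ : Set V → R) :
    clusterObs ends U s (F₁ * F₂) = clusterObs ends U s F₁ * clusterObs ends U s F₂ := rfl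

/-- `clusterObs` of the constant `1` is `1`. -/
lemma clusterObs_one [One R] : clusterObs ends U s (fun _ => (1 : R)) = 1 := rfl

/-- On `{s ↮ Z in G[U]}` the cluster of `s` in `G[U ∖ Z]` is its cluster in `G[U]`. -/
lemma clusterIn_sdiff_eq [DecidableEq V] {Z : Finset V} {ω : Config E}
    (hR : ∀ z ∈ Z, ¬ Conn ends (induced ends (↑U) ω) s z) :
    clusterIn ends (U \ Z) s ω = clusterIn ends U s ω := by
  ext x
  simp only [mem_clusterIn]
  exact ⟨conn_mono (induced_mono_set (Finset.coe_subset.2 Finset.sdiff_subset) ω),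
    conn_induced_sdiff_of_conn hR⟩

end ClusterObs

/-! ## Harris' inequality for an observable and a decreasing event -/

section HarrisObs

/-- `f · 1_{Aᶜ} = f − f · 1_A`. -/
lemma mul_indicator_compl {E : Type*} {R : Type*} [CommRing R] (f : Config E → R)
    (A : Set (Config E)) : f * Aᶜ.indicator 1 = f - f * A.indicator 1 := by
  funext ω
  by_cases h : ω ∈ A
  · simp [h]
  · simp [h]

variable {E : Type*} [Fintype E] [DecidableEq E] {R : Type*} [CommRing R] [LinearOrder R]
  [IsStrictOrderedRing R]

/-- **Harris' inequality, mixed form for observables**: for a monotone observable `f` and a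
decreasing event `A`, `E(f 1_A) ≤ E f · P(A)`. -/
theorem expect_mul_indicator_le_of_isLowerSet {p : E → R} (hp : IsProbVec p) {f : Config E → R}
    (hf : Monotone f) {A : Set (Config E)} (hA : IsLowerSet A) :
    expect p (f * A.indicator 1) ≤ expect p f * prob p A := by
  have h := expect_mul_expect_le_expect_mul hp hf (monotone_indicator_of_isUpperSet (R := R) hA.compl)
  rw [← prob_eq_expect_indicator, prob_compl, mul_indicator_compl, expect_sub] at h
  linear_combination h

end HarrisObs

/-! ## The inequality on induced subgraphs -/

section BHKMain

variable {V : Type*} {E : Type*} [Fintype E] [DecidableEq E] [Fintype V] [DecidableEq V]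
  {R : Type*} [CommRing R] [LinearOrder R] [IsStrictOrderedRing R]

omit [Fintype E] [DecidableEq E] [Fintype V] [DecidableEq V] in
/-- Nonnegativity of `F(C_s) · 1_A` for a nonnegative functional. -/
lemma clusterObs_mul_indicator_nonneg (ends : E → Sym2 V) (U : Finset V) (s : V)
    {F : Set V → R} (hF : ∀ ω : Config E, 0 ≤ F (cluster ends ω s)) (A : Set (Config E))
    (ω : Config E) : 0 ≤ (clusterObs ends U s F * A.indicator (1 : Config E → R)) ω :=
  mul_nonneg (hF _) (Set.indicator_apply_nonneg fun _ => zero_le_one)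

omit [Fintype V] [DecidableEq V] in
/-- Monotonicity in the event: `E(F(C_s) 1_A) ≤ E(F(C_s) 1_B)` for `A ⊆ B` and `F ≥ 0`. -/
lemma expect_clusterObs_mul_indicator_mono {p : E → R} (hp : IsProbVec p) (ends : E → Sym2 V)
    (U : Finset V) (s : V) {F : Set V → R} (hF : ∀ ω : Config E, 0 ≤ F (cluster ends ω s))
    {A B : Set (Config E)} (hAB : A ⊆ B) :
    expect p (clusterObs ends U s F * A.indicator 1) ≤
      expect p (clusterObs ends U s F * B.indicator 1) := by
  refine expect_mono hp fun ω => ?_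
  simp only [Pi.mul_apply]
  refine mul_le_mul_of_nonneg_left ?_ (hF _)
  by_cases h : ω ∈ A
  · rw [Set.indicator_of_mem h, Set.indicator_of_mem (hAB h)]
  · rw [Set.indicator_of_notMem h]
    exact Set.indicator_apply_nonneg fun _ => zero_le_one

omit [Fintype V] in
/-- The case `X ∩ Y = ∅`: Harris' inequality three times. -/
lemma bhk_induced_of_inter_eq_empty (p : E → R) (hp : IsProbVec p) (ends : E → Sym2 V) (s : V)
    (U : Finset V) {F₁ F₂ : Set V → R}
    (hF₁ : ∀ ω ω' : Config E, cluster ends ω s ⊆ cluster ends ω' s →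
      F₁ (cluster ends ω s) ≤ F₁ (cluster ends ω' s))
    (hF₂ : ∀ ω ω' : Config E, cluster ends ω s ⊆ cluster ends ω' s →
      F₂ (cluster ends ω s) ≤ F₂ (cluster ends ω' s))
    (hF₁0 : ∀ ω : Config E, 0 ≤ F₁ (cluster ends ω s))
    (hF₂0 : ∀ ω : Config E, 0 ≤ F₂ (cluster ends ω s)) (X Y : Finset V) (hZ : X ∩ Y = ∅) :
    expect p (clusterObs ends U s F₁ * (REvent ends U s X).indicator 1) *
        expect p (clusterObs ends U s F₂ * (REvent ends U s Y).indicator 1) ≤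
      expect p (clusterObs ends U s (F₁ * F₂) * (REvent ends U s (X ∩ Y)).indicator 1) *
        prob p (REvent ends U s (X ∪ Y)) := by
  rw [hZ, REvent_empty, Set.indicator_univ, mul_one, REvent_union, clusterObs_mul]
  have hRX := isLowerSet_REvent ends U s X
  have hRY := isLowerSet_REvent ends U s Y
  have h1 := expect_mul_indicator_le_of_isLowerSet hp (monotone_clusterObs' (ends := ends) (U := U)
    (s := s) hF₁) hRX
  have h2 := expect_mul_indicator_le_of_isLowerSet hp (monotone_clusterObs' (ends := ends) (U := U)
    (s := s) hF₂) hRY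
  have h3 := expect_mul_expect_le_expect_mul hp (monotone_clusterObs' (ends := ends) (U := U)
    (s := s) hF₁) (monotone_clusterObs' (ends := ends) (U := U) (s := s) hF₂)
  have h4 := prob_mul_prob_le_prob_inter_of_isLowerSet hp hRX hRY
  have n1 : 0 ≤ expect p (clusterObs ends U s F₂ * (REvent ends U s Y).indicator 1) :=
    expect_nonneg hp (clusterObs_mul_indicator_nonneg ends U s hF₂0 _)
  have n2 : 0 ≤ expect p (clusterObs ends U s F₁) := expect_nonneg hp fun ω => hF₁0 _
  have n3 : 0 ≤ expect p (clusterObs ends U s F₁ * clusterObs ends U s F₂) :=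
    expect_nonneg hp fun ω => mul_nonneg (hF₁0 _) (hF₂0 _)
  calc expect p (clusterObs ends U s F₁ * (REvent ends U s X).indicator 1) *
        expect p (clusterObs ends U s F₂ * (REvent ends U s Y).indicator 1)
      ≤ (expect p (clusterObs ends U s F₁) * prob p (REvent ends U s X)) *
          (expect p (clusterObs ends U s F₂) * prob p (REvent ends U s Y)) :=
        mul_le_mul h1 h2 n1 (mul_nonneg n2 (prob_nonneg hp _))
    _ = (expect p (clusterObs ends U s F₁) * expect p (clusterObs ends U s F₂)) *
          (prob p (REvent ends U s X) * prob p (REvent ends U s Y)) := by ring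
    _ ≤ expect p (clusterObs ends U s F₁ * clusterObs ends U s F₂) *
          prob p (REvent ends U s X ∩ REvent ends U s Y) :=
        mul_le_mul h3 h4 (mul_nonneg (prob_nonneg hp _) (prob_nonneg hp _)) n3

omit [DecidableEq E] [Fintype V] [LinearOrder R] [IsStrictOrderedRing R] in
/-- **Pointwise transfer to `G[U ∖ Z]`**: for `s ∉ Z ⊆ U`,
`F(C^U_s) · 1_{R^U_{W ∪ Z}} = F(C^{U∖Z}_s) · 1_{R^{U∖Z}_{W ∪ frontier}}` configuration by
configuration. -/
lemma clusterObs_mul_indicator_eq (ends : E → Sym2 V) {U Z : Finset V} (hZU : Z ⊆ U) {s : V}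
    (hsZ : s ∉ Z) (F : Set V → R) (W : Finset V) (ω : Config E) :
    (clusterObs ends U s F * (REvent ends U s (W ∪ Z)).indicator (1 : Config E → R)) ω =
      (clusterObs ends (U \ Z) s F *
        (REvent ends (U \ Z) s (W ∪ frontier ends U Z ω)).indicator (1 : Config E → R)) ω := by
  have key := Set.ext_iff.1 (QEvent_inter_REvent_union_eq (ends := ends) hZU hsZ ∅ W) ω
  simp only [QEvent_empty, Set.univ_inter, Set.mem_setOf_eq] at key
  simp only [Pi.mul_apply]
  by_cases h : ω ∈ REvent ends U s (W ∪ Z)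
  · have hR : ∀ z ∈ Z, ¬ Conn ends (induced ends (↑U) ω) s z :=
      fun z hz => h z (Finset.mem_union_right W hz)
    rw [Set.indicator_of_mem h, Set.indicator_of_mem (key.1 h), clusterObs_apply, clusterObs_apply,
      clusterIn_sdiff_eq hR]
  · rw [Set.indicator_of_notMem h, Set.indicator_of_notMem fun h' => h (key.2 h'), mul_zero,
      mul_zero]

omit [LinearOrder R] [IsStrictOrderedRing R] in
/-- **Domain Markov identity for cluster functionals**: for `s ∉ Z ⊆ U`,
`E(F(C^U_s) 1_{R^U_{W∪Z}}) = ∑_ω weight p ω · E(F(C^{U∖Z}_s) 1_{R^{U∖Z}_{W ∪ frontier ω}})`. -/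
theorem expect_clusterObs_mul_indicator_eq_sum (p : E → R) (ends : E → Sym2 V) {U Z : Finset V}
    (hZU : Z ⊆ U) {s : V} (hsZ : s ∉ Z) (F : Set V → R) (W : Finset V) :
    expect p (clusterObs ends U s F * (REvent ends U s (W ∪ Z)).indicator 1) =
      ∑ ω, weight p ω * expect p (clusterObs ends (U \ Z) s F *
        (REvent ends (U \ Z) s (W ∪ frontier ends U Z ω)).indicator 1) := by
  have e : (clusterObs ends U s F * (REvent ends U s (W ∪ Z)).indicator (1 : Config E → R)) =
      fun ω => (clusterObs ends (U \ Z) s F *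
        (REvent ends (U \ Z) s (W ∪ frontier ends U Z ω)).indicator (1 : Config E → R)) ω :=
    funext fun ω => clusterObs_mul_indicator_eq ends hZU hsZ F W ω
  rw [e]
  exact expect_tower p (F₁ := fun _ => touches ends (↑Z)) (F₂ := fun _ => within ends (↑(U \ Z)))
    (S := frontier ends U Z)
    (Φ := fun T => clusterObs ends (U \ Z) s F * (REvent ends (U \ Z) s (W ∪ T)).indicator 1)
    (fun _ => disjoint_touches_within_sdiff ends U Z)
    (fun T ω ω' h => by
      show (frontier ends U Z ω = T) = (frontier ends U Z ω' = T)
      rw [dependsOn_frontier ends U Z h])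
    fun T => dependsOn_mul (dependsOn_clusterObs F)
      (dependsOn_indicator (dependsOn_REvent ends (U \ Z) s (W ∪ T)))

/-- **van den Berg–Häggström–Kahn on induced subgraphs** (functional form, minimal hypotheses):
for cluster functionals `F₁, F₂` that are nonnegative and monotone on the clusters of `s`, every
vertex set `U` and `X, Y ⊆ U`,
`E(F₁(C^U_s) 1_{R^U_X}) · E(F₂(C^U_s) 1_{R^U_Y}) ≤ E((F₁F₂)(C^U_s) 1_{R^U_{X∩Y}}) · P(R^U_{X∪Y})`. -/
theorem bhk_induced' (p : E → R) (hp : IsProbVec p) (ends : E → Sym2 V) (s : V)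
    {F₁ F₂ : Set V → R}
    (hF₁ : ∀ ω ω' : Config E, cluster ends ω s ⊆ cluster ends ω' s →
      F₁ (cluster ends ω s) ≤ F₁ (cluster ends ω' s))
    (hF₂ : ∀ ω ω' : Config E, cluster ends ω s ⊆ cluster ends ω' s →
      F₂ (cluster ends ω s) ≤ F₂ (cluster ends ω' s))
    (hF₁0 : ∀ ω : Config E, 0 ≤ F₁ (cluster ends ω s))
    (hF₂0 : ∀ ω : Config E, 0 ≤ F₂ (cluster ends ω s)) (U : Finset V) :
    ∀ X Y : Finset V, X ⊆ U → Y ⊆ U →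
      expect p (clusterObs ends U s F₁ * (REvent ends U s X).indicator 1) *
          expect p (clusterObs ends U s F₂ * (REvent ends U s Y).indicator 1) ≤
        expect p (clusterObs ends U s (F₁ * F₂) * (REvent ends U s (X ∩ Y)).indicator 1) *
          prob p (REvent ends U s (X ∪ Y)) := by
  have hF0 : ∀ ω : Config E, 0 ≤ (F₁ * F₂) (cluster ends ω s) :=
    fun ω => mul_nonneg (hF₁0 ω) (hF₂0 ω)
  induction U using Finset.strongInduction with
  | H U ih =>
  intro X Y hX hY
  by_cases hZ : X ∩ Y = ∅
  · exact bhk_induced_of_inter_eq_empty p hp ends s U hF₁ hF₂ hF₁0 hF₂0 X Y hZ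
  -- the exploration step: `Z = X ∩ Y ≠ ∅`
  set Z := X ∩ Y with hZdef
  have hZX : Z ⊆ X := Finset.inter_subset_left
  have hZY : Z ⊆ Y := Finset.inter_subset_right
  have hZU : Z ⊆ U := hZX.trans hX
  by_cases hsZ : s ∈ Z
  · -- `s ∈ X`: the left side vanishes
    have h0 : expect p (clusterObs ends U s F₁ * (REvent ends U s X).indicator 1) = 0 := by
      rw [REvent_eq_empty_of_mem ends U (hZX hsZ)]
      simp [expect]
    rw [h0, zero_mul]
    exact mul_nonneg (expect_nonneg hp (clusterObs_mul_indicator_nonneg ends U s hF0 _))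
      (prob_nonneg hp _)
  have hU' : U \ Z ⊂ U := Finset.sdiff_ssubset hZU (Finset.nonempty_iff_ne_empty.2 hZ)
  -- the four terms as sums over configurations (domain Markov identity)
  have e1 : expect p (clusterObs ends U s F₁ * (REvent ends U s X).indicator 1) =
      ∑ ω, weight p ω * expect p (clusterObs ends (U \ Z) s F₁ *
        (REvent ends (U \ Z) s ((X \ Z) ∪ frontier ends U Z ω)).indicator 1) := by
    rw [← expect_clusterObs_mul_indicator_eq_sum p ends hZU hsZ F₁ (X \ Z),
      Finset.sdiff_union_of_subset hZX]
  have e2 : expect p (clusterObs ends U s F₂ * (REvent ends U s Y).indicator 1) =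
      ∑ ω, weight p ω * expect p (clusterObs ends (U \ Z) s F₂ *
        (REvent ends (U \ Z) s ((Y \ Z) ∪ frontier ends U Z ω)).indicator 1) := by
    rw [← expect_clusterObs_mul_indicator_eq_sum p ends hZU hsZ F₂ (Y \ Z),
      Finset.sdiff_union_of_subset hZY]
  have e3 : expect p (clusterObs ends U s (F₁ * F₂) * (REvent ends U s Z).indicator 1) =
      ∑ ω, weight p ω * expect p (clusterObs ends (U \ Z) s (F₁ * F₂) *
        (REvent ends (U \ Z) s (∅ ∪ frontier ends U Z ω)).indicator 1) := by
    rw [← expect_clusterObs_mul_indicator_eq_sum p ends hZU hsZ (F₁ * F₂) ∅, Finset.empty_union]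
  have e4 : prob p (REvent ends U s (X ∪ Y)) =
      ∑ ω, weight p ω * expect p (clusterObs ends (U \ Z) s (fun _ => 1) *
        (REvent ends (U \ Z) s (((X \ Z) ∪ (Y \ Z)) ∪ frontier ends U Z ω)).indicator 1) := by
    rw [← expect_clusterObs_mul_indicator_eq_sum p ends hZU hsZ (fun _ => 1) ((X \ Z) ∪ (Y \ Z)),
      clusterObs_one, one_mul, ← prob_eq_expect_indicator, ← Finset.union_sdiff_distrib,
      Finset.sdiff_union_of_subset (hZX.trans Finset.subset_union_left)]
  rw [e1, e2, e3, e4]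
  -- the four functions theorem on the lattice `Config E`
  refine four_functions_theorem_univ
    (fun ω => weight p ω * expect p (clusterObs ends (U \ Z) s F₁ *
      (REvent ends (U \ Z) s ((X \ Z) ∪ frontier ends U Z ω)).indicator 1))
    (fun ω => weight p ω * expect p (clusterObs ends (U \ Z) s F₂ *
      (REvent ends (U \ Z) s ((Y \ Z) ∪ frontier ends U Z ω)).indicator 1))
    (fun ω => weight p ω * expect p (clusterObs ends (U \ Z) s (F₁ * F₂) *
      (REvent ends (U \ Z) s (∅ ∪ frontier ends U Z ω)).indicator 1))
    (fun ω => weight p ω * expect p (clusterObs ends (U \ Z) s (fun _ => 1) *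
      (REvent ends (U \ Z) s (((X \ Z) ∪ (Y \ Z)) ∪ frontier ends U Z ω)).indicator 1))
    (fun ω => mul_nonneg (weight_nonneg hp ω)
      (expect_nonneg hp (clusterObs_mul_indicator_nonneg ends _ s hF₁0 _)))
    (fun ω => mul_nonneg (weight_nonneg hp ω)
      (expect_nonneg hp (clusterObs_mul_indicator_nonneg ends _ s hF₂0 _)))
    (fun ω => mul_nonneg (weight_nonneg hp ω)
      (expect_nonneg hp (clusterObs_mul_indicator_nonneg ends _ s hF0 _)))
    (fun ω => mul_nonneg (weight_nonneg hp ω)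
      (expect_nonneg hp (clusterObs_mul_indicator_nonneg ends _ s (fun _ => zero_le_one) _))) ?_
  intro ω ω'
  -- induction hypothesis on `U ∖ Z` with the frontiers added to the avoided sets
  have hX'' : (X \ Z) ∪ frontier ends U Z ω ⊆ U \ Z :=
    Finset.union_subset (Finset.sdiff_subset_sdiff hX (le_refl Z)) (frontier_subset ω)
  have hY'' : (Y \ Z) ∪ frontier ends U Z ω' ⊆ U \ Z :=
    Finset.union_subset (Finset.sdiff_subset_sdiff hY (le_refl Z)) (frontier_subset ω')
  have hIH := ih (U \ Z) hU' ((X \ Z) ∪ frontier ends U Z ω) ((Y \ Z) ∪ frontier ends U Z ω')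
    hX'' hY''
  -- `S(ω ⊓ ω') ⊆ S(ω) ∩ S(ω') ⊆ X'' ∩ Y''`
  have h3 : expect p (clusterObs ends (U \ Z) s (F₁ * F₂) * (REvent ends (U \ Z) s
      (((X \ Z) ∪ frontier ends U Z ω) ∩ ((Y \ Z) ∪ frontier ends U Z ω'))).indicator 1) ≤
      expect p (clusterObs ends (U \ Z) s (F₁ * F₂) *
        (REvent ends (U \ Z) s (∅ ∪ frontier ends U Z (ω ⊓ ω'))).indicator 1) := by
    refine expect_clusterObs_mul_indicator_mono hp ends _ s hF0 (REvent_anti _ _ _ ?_)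
    rw [Finset.empty_union]
    exact (frontier_inf_subset ω ω').trans
      (Finset.inter_subset_inter Finset.subset_union_right Finset.subset_union_right)
  -- `X'' ∪ Y'' = (X' ∪ Y') ∪ S(ω ⊔ ω')`
  have h4 : prob p (REvent ends (U \ Z) s
      (((X \ Z) ∪ frontier ends U Z ω) ∪ ((Y \ Z) ∪ frontier ends U Z ω'))) =
      expect p (clusterObs ends (U \ Z) s (fun _ => 1) *
        (REvent ends (U \ Z) s (((X \ Z) ∪ (Y \ Z)) ∪ frontier ends U Z (ω ⊔ ω'))).indicator 1) := by
    rw [clusterObs_one, one_mul, ← prob_eq_expect_indicator, frontier_sup]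
    congr 2
    ext x
    simp only [Finset.mem_union]
    tauto
  have n3 : 0 ≤ expect p (clusterObs ends (U \ Z) s (F₁ * F₂) *
      (REvent ends (U \ Z) s (∅ ∪ frontier ends U Z (ω ⊓ ω'))).indicator 1) :=
    expect_nonneg hp (clusterObs_mul_indicator_nonneg ends _ s hF0 _)
  have n4 : 0 ≤ prob p (REvent ends (U \ Z) s
      (((X \ Z) ∪ frontier ends U Z ω) ∪ ((Y \ Z) ∪ frontier ends U Z ω'))) := prob_nonneg hp _
  calc weight p ω * expect p (clusterObs ends (U \ Z) s F₁ *
          (REvent ends (U \ Z) s ((X \ Z) ∪ frontier ends U Z ω)).indicator 1) *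
        (weight p ω' * expect p (clusterObs ends (U \ Z) s F₂ *
          (REvent ends (U \ Z) s ((Y \ Z) ∪ frontier ends U Z ω')).indicator 1))
      = (weight p ω * weight p ω') *
          (expect p (clusterObs ends (U \ Z) s F₁ *
            (REvent ends (U \ Z) s ((X \ Z) ∪ frontier ends U Z ω)).indicator 1) *
          expect p (clusterObs ends (U \ Z) s F₂ *
            (REvent ends (U \ Z) s ((Y \ Z) ∪ frontier ends U Z ω')).indicator 1)) := by ring
    _ ≤ (weight p ω * weight p ω') *
          (expect p (clusterObs ends (U \ Z) s (F₁ * F₂) *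
            (REvent ends (U \ Z) s (∅ ∪ frontier ends U Z (ω ⊓ ω'))).indicator 1) *
          expect p (clusterObs ends (U \ Z) s (fun _ => 1) *
            (REvent ends (U \ Z) s (((X \ Z) ∪ (Y \ Z)) ∪
              frontier ends U Z (ω ⊔ ω'))).indicator 1)) :=
        mul_le_mul_of_nonneg_left (hIH.trans (mul_le_mul h3 (le_of_eq h4) n4 n3))
          (mul_nonneg (weight_nonneg hp ω) (weight_nonneg hp ω'))
    _ = weight p (ω ⊓ ω') * expect p (clusterObs ends (U \ Z) s (F₁ * F₂) *
          (REvent ends (U \ Z) s (∅ ∪ frontier ends U Z (ω ⊓ ω'))).indicator 1) *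
        (weight p (ω ⊔ ω') * expect p (clusterObs ends (U \ Z) s (fun _ => 1) *
          (REvent ends (U \ Z) s (((X \ Z) ∪ (Y \ Z)) ∪
            frontier ends U Z (ω ⊔ ω'))).indicator 1)) := by
        rw [← weight_inf_mul_weight_sup p ω ω']
        ring

/-- **van den Berg–Häggström–Kahn on induced subgraphs** (functional form) for nonnegative
monotone cluster functionals `F₁, F₂`. -/
theorem bhk_induced (p : E → R) (hp : IsProbVec p) (ends : E → Sym2 V) (s : V)
    {F₁ F₂ : Set V → R} (hF₁ : Monotone F₁) (hF₂ : Monotone F₂) (hF₁0 : ∀ S, 0 ≤ F₁ S)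
    (hF₂0 : ∀ S, 0 ≤ F₂ S) (U : Finset V) :
    ∀ X Y : Finset V, X ⊆ U → Y ⊆ U →
      expect p (clusterObs ends U s F₁ * (REvent ends U s X).indicator 1) *
          expect p (clusterObs ends U s F₂ * (REvent ends U s Y).indicator 1) ≤
        expect p (clusterObs ends U s (F₁ * F₂) * (REvent ends U s (X ∩ Y)).indicator 1) *
          prob p (REvent ends U s (X ∪ Y)) :=
  bhk_induced' p hp ends s (fun _ _ h => hF₁ h) (fun _ _ h => hF₂ h) (fun _ => hF₁0 _)
    (fun _ => hF₂0 _) U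

end BHKMain

end Summit.Ventures.PercRepro2
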